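import Summits.CriticalPhenomena.CardyFormulaZ2.Theorems.CardyFlipRussoVoronoiHubFromSmirnovDefs
import Literature.Probability.LatticeModels.DelaunayGraph
import Literature.Topology.PlaneTopology.AnnulusArcs

/-!
# Stub `voronoiCell_subset_closedBall_of_noVoid` of line `moebius-exact-delaunay-dilation-ward`
# (crux `VoronoiHubFromSmirnov`, stmt-CriticalPhenomena-6433)

CELLS ARE SMALL WHERE THERE ARE NO VOIDS.  Let `ω ⊆ ℂ` be any set of sites (nuclei), `p : ℂ`,
`ℓ > 0`, and let `A ⊆ ℂ` be a region containing the closed disc `Metric.closedBall p ℓ` such that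
every point of `A` has a site of `ω` at distance `< ℓ / 2` ("no void of radius `ℓ / 2` meets `A`").
Then the closed Voronoi cell of `p`
(`Literature.Probability.LatticeModels.voronoiCell ω p = {x | ∀ d ∈ ω, dist x p ≤ dist x d}`;
`p ∈ ω` is not required) is contained in `Metric.closedBall p ℓ`.  This is the deterministic content
of the "no giant cells" event of I. Benjamini, O. Schramm, *Conformal invariance of Voronoi
percolation*, Comm. Math. Phys. 197 (1998), §4, and of B. Bollobás, O. Riordan, *Percolation*
(CUP 2006), Ch. 8 §8.2; it feeds the cell-size hypotheses of `defect_implies_potentialDefect` and of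
the Delaunay pivoting lemma `delaunay_pivot_exists_third` /
`exists_site_left_of_voronoiCell_bounded`.

Proof (triangle inequality only; no convexity, no finiteness).  Let `z` lie in the cell and suppose
`ℓ < dist z p =: r`.  Retract `z` radially onto the circle of radius `ℓ` about `p`:
`z' := p + (ℓ / r) (z − p)` has `dist z' p = ℓ` and `dist z z' = r − ℓ` (`cnv_exists_retract`,
via the landed ray-distance formula `Literature.Topology.PlaneTopology.dist_ray_point` and its
companion `cnv_dist_retract_self`).
Since `z' ∈ closedBall p ℓ ⊆ A`, some site `d ∈ ω` has `dist z' d < ℓ / 2`, whence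

  `dist z d ≤ dist z z' + dist z' d < (r − ℓ) + ℓ / 2 < r = dist z p`,

contradicting `dist z p ≤ dist z d` (membership of `z` in the cell).

No new definitions.
-/

noncomputable section

namespace Summit.CriticalPhenomena.CardyFormulaZ2.Cruxes.VoronoiHubFromSmirnov.MoebiusExactDelaunayDilationWard

/-- Distance from the retracted point to the original one: for `s ≤ 1` the point `p + s (z − p)` of
the ray from `p` through `z` is at distance `(1 − s) · dist z p` from `z` (companion of
`Literature.Topology.PlaneTopology.dist_ray_point`, which gives its distance `s · dist z p` from `p`).
[folklore] -/
theorem cnv_dist_retract_self (p z : ℂ) {s : ℝ} (hs : s ≤ 1) :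
    dist z (p + (s : ℂ) * (z - p)) = (1 - s) * dist z p := by
  have h : z - (p + (s : ℂ) * (z - p)) = ((1 - s : ℝ) : ℂ) * (z - p) := by
    push_cast
    ring
  rw [Complex.dist_eq, Complex.dist_eq, h, norm_mul, Complex.norm_real,
    Real.norm_of_nonneg (sub_nonneg.mpr hs)]

/-- **Radial retraction onto a circle.** If `0 ≤ ℓ < dist z p`, some point `z'` (namely
`p + (ℓ / dist z p) (z − p)`, the point of the segment `[p, z]` at distance `ℓ` from `p`) satisfies
`dist z' p = ℓ` and `dist z z' = dist z p − ℓ`. [folklore] -/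
theorem cnv_exists_retract {p z : ℂ} {ℓ : ℝ} (hℓ : 0 ≤ ℓ) (h : ℓ < dist z p) :
    ∃ z' : ℂ, dist z' p = ℓ ∧ dist z z' = dist z p - ℓ := by
  have hr : 0 < dist z p := hℓ.trans_lt h
  refine ⟨p + ((ℓ / dist z p : ℝ) : ℂ) * (z - p), ?_, ?_⟩
  · rw [Literature.Topology.PlaneTopology.dist_ray_point p z (div_nonneg hℓ hr.le),
      div_mul_cancel₀ ℓ hr.ne']
  · rw [cnv_dist_retract_self p z ((div_le_one hr).mpr h.le), sub_mul, one_mul,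
      div_mul_cancel₀ ℓ hr.ne']

/-- **Cells are small where there are no voids.**  If `ℓ > 0`, `closedBall p ℓ ⊆ A`, and every
point of `A` has a site of `ω` at distance `< ℓ / 2`, then the closed Voronoi cell of `p` with
respect to `ω` is contained in `closedBall p ℓ`: a cell point `z` with `dist z p > ℓ` retracts
radially to a point `z'` of the circle of radius `ℓ` about `p` (`cnv_exists_retract`), which lies in
`A` and hence has a site `d` within `ℓ / 2`; then `dist z d < dist z p`, contradicting `z ∈ cell`.
[folklore] -/
theorem voronoiCell_subset_closedBall_of_noVoid : ∀ (ω A : Set ℂ) (p : ℂ) (ℓ : ℝ), 0 < ℓ → Metric.closedBall p ℓ ⊆ A → (∀ z ∈ A, ∃ d ∈ ω, dist z d < ℓ / 2) → Literature.Probability.LatticeModels.voronoiCell ω p ⊆ Metric.closedBall p ℓ := by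
  intro ω A p ℓ hℓ hA hvoid z hz
  rw [Metric.mem_closedBall]
  by_contra! h
  obtain ⟨z', hz'p, hzz'⟩ := cnv_exists_retract hℓ.le h
  obtain ⟨d, hd, hdist⟩ := hvoid z' (hA (Metric.mem_closedBall.mpr hz'p.le))
  have h1 : dist z p ≤ dist z d := hz d hd
  have h2 : dist z d ≤ dist z z' + dist z' d := dist_triangle z z' d
  linarith

end Summit.CriticalPhenomena.CardyFormulaZ2.Cruxes.VoronoiHubFromSmirnov.MoebiusExactDelaunayDilationWard

end
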